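import Mathlib
import Summits.KontsevichZagierPeriods.Zeta5Search.LaiKappa3SweepCert
import Summits.KontsevichZagierPeriods.Zeta5Search.LaiBoxLadderPrint
import Literature.NumberTheory.Irrationality.FischlerZudilin2010.OddZetaDim139
import Literature.NumberTheory.Transcendental.AperyIrrationality
import HarnessLib

/-!
# The certified rung read on the κ₃ ladder: corollaries of `3 ≤ oddZetaSpanRank 36`

HONEST FRAMING: systematic search; no irrationality claim unless certified. Pub cell `pub-zeta5`
(summit KontsevichZagierPeriods, topic Zeta5Search), family `indep` (LINEAR INDEPENDENCE / DIMENSION),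
generation 7. This file adds NO mathematics: it reads the hypothesis-free kernel theorem
`Sweep.kappa3_sweep_three_le_oddZetaSpanRank : 3 ≤ oddZetaSpanRank 36` (`LaiKappa3SweepCert.lean`;
`oddZetaSpanRank m = dim_ℚ Span_ℚ(1, ζ(3), ζ(5), …, ζ(2m+1))`, `LaiBoxDimension.lean`) in the forms
a reader of the literature expects, each a short consequence of the monotonicity of the ladder
(`oddZetaSpanRank_mono`), of the set form of the rung vector (`oddZetaSpanRank_eq_finrank_span_insert`)
and of `dim Span_ℚ(1, ζ(3)) ≤ 2`:

* `kappa3_sweep_three_le_finrank_span` — the statement WITHOUT the cell's wrapper, in the shape of the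
  tree's printed dimension facts: `3 ≤ dim_ℚ Span_ℚ (insert 1 {ζ(k) : k odd, 3 ≤ k ≤ 73})`;
* `kappa3_sweep_three_le_oddZetaSpanRank_le` — every rung `m' ≥ 36` of the ladder, hypothesis-free;
  in particular `three_le_oddZetaSpanRank_37`, the STATEMENT of Lai's computer-assisted
  [Lai2024BallRivoal, Claim 1.4] (`dim_ℚ Span_ℚ(1, ζ(3), …, ζ(75)) ≥ 3`, stated there as a claim because
  its computation was not offered to the referee) — obtained here at THIS TREE's point
  `(J, r, M; δ) = (74, 2180, 444; δ74)`, NOT by checking Lai's Table 2 computation at `(76, 2444, 444)`;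
* `fischlerZudilin2010_oddZetaDim139` — the tree's NAMED FACT for the refereed record in print,
  `κ₃ ≤ 139` [FischlerZudilin2010, Thm 3, §3.1] (`Literature/…/FischlerZudilin2010/OddZetaDim139.lean`,
  so far used only as a hypothesis, `LaiBoxLadderPrint.lean`), now PROVED in the tree — by Lai's method at
  the point above, not by formalising Fischler–Zudilin's own proof;
* `exists_oddZeta_not_mem_span_one_zetaThree` / `exists_linearIndependent_one_zetaThree_oddZeta` —
  the rung in words: some `ζ(k)`, `5 ≤ k ≤ 73` odd, lies OUTSIDE `ℚ + ℚ ζ(3)` (from the dimension alone: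
  otherwise the whole span sits inside the `≤ 2`-dimensional `Span_ℚ(1, ζ(3))`), hence — with Apéry's
  theorem, the tree's `Apery.irrational_zeta_three` — `1, ζ(3), ζ(k)` are linearly independent over `ℚ` for
  some odd `k ≤ 73` (compare [FischlerZudilin2010, Thm 3]: odd `i₁ ≤ 139`, `i₂ ≤ 1961` with
  `1, ζ(3), ζ(i₁), ζ(i₂)` independent — a four-term statement this file does not touch).

What this is NOT: an irrationality result for `ζ(5)` or for any single odd zeta value; it moves no
`ζ(5)` record. The irrationality gloss one can read off a dimension `≥ 3` ('besides `1`, two of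
`ζ(3), ζ(5), …, ζ(73)` are irrational', 'one of `ζ(5), …, ζ(73)` is irrational') is WEAKER than Zudilin's
theorem in print that one of `ζ(5), ζ(7), ζ(9), ζ(11)` is irrational; the content of the certified rung is
the LINEAR INDEPENDENCE (dimension) statement, whose refereed record is `…, ζ(139)` and whose claimed
record was `…, ζ(75)`.

References: [Lai2024BallRivoal] L. Lai, arXiv:2407.14236, Claim 1.4 (p. 3), §13 (p. 47: the ladder
`169 → 145 → 139 → 75`); [FischlerZudilin2010] S. Fischler, W. Zudilin, Math. Ann. 347 (2010), Thm 3 and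
§3.1.
-/

namespace Summit.KontsevichZagierPeriods.Zeta5Search.Sweep

open Literature.NumberTheory.Transcendental Literature.NumberTheory.Transcendental.Apery
  Literature.NumberTheory.Irrationality

/-- **The certified rung in printed form**: `3 ≤ dim_ℚ Span_ℚ (insert 1 {ζ(k) : k odd, 3 ≤ k ≤ 73})`,
i.e. `dim_ℚ Span_ℚ(1, ζ(3), ζ(5), …, ζ(73)) ≥ 3`, with no cell-specific wrapper (the set is written exactly
as in the tree's `ball_rivoal` / `FischlerZudilin2010.oddZetaDim139`). Hypothesis-free; from
`kappa3_sweep_three_le_oddZetaSpanRank` by `oddZetaSpanRank_eq_finrank_span_insert 36`.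
[cite: Lai2024BallRivoal, Claim 1.4 (ζ(75)) sharpened to ζ(73); method §4–§5] -/
theorem kappa3_sweep_three_le_finrank_span :
    3 ≤ Module.finrank ℚ (Submodule.span ℚ
      (insert (1 : ℝ) {x | ∃ k : ℕ, Odd k ∧ 3 ≤ k ∧ k ≤ 73 ∧ x = zetaValue k})) := by
  have h := kappa3_sweep_three_le_oddZetaSpanRank
  rwa [oddZetaSpanRank_eq_finrank_span_insert] at h

/-- **Every rung `m' ≥ 36`**: `3 ≤ dim_ℚ Span_ℚ(1, ζ(3), …, ζ(2m'+1))` for all `m' ≥ 36`, hypothesis-free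
(monotonicity of the ladder, `oddZetaSpanRank_mono`). [cite: FischlerZudilin2010, Thm 2.1] -/
theorem kappa3_sweep_three_le_oddZetaSpanRank_le {m' : ℕ} (hm' : 36 ≤ m') : 3 ≤ oddZetaSpanRank m' :=
  kappa3_sweep_three_le_oddZetaSpanRank.trans (oddZetaSpanRank_mono hm')

/-- **The statement of Lai's Claim 1.4 as a kernel theorem**: `3 ≤ oddZetaSpanRank 37`, i.e.
`dim_ℚ Span_ℚ(1, ζ(3), ζ(5), …, ζ(75)) ≥ 3` — the rung `m' = 37`, one above the certified one. Obtained at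
this tree's point `(74, 2180, 444; δ74)`, NOT by verifying the computation behind [Lai2024BallRivoal,
Claim 1.4] at Lai's point `(76, 2444, 444)`. [cite: Lai2024BallRivoal, Claim 1.4] -/
theorem three_le_oddZetaSpanRank_37 : 3 ≤ oddZetaSpanRank 37 :=
  kappa3_sweep_three_le_oddZetaSpanRank_le (by norm_num)

/-- **The refereed record in print, discharged**: the tree's named fact
`FischlerZudilin2010.oddZetaDim139` (`dim_ℚ Span_ℚ(1, ζ(3), ζ(5), …, ζ(139)) ≥ 3`, [FischlerZudilin2010,
Thm 3 / §3.1], hitherto a hypothesis of `LaiBoxLadderPrint.lean`) HOLDS — proved here from the certified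
rung `m = 36 ≤ 69` by monotonicity, i.e. by Lai's method at `(74, 2180, 444; δ74)`, not by formalising
Fischler–Zudilin's proof. [cite: FischlerZudilin2010, Thm 3 (§3.1, s = 70, t = 10)] -/
theorem fischlerZudilin2010_oddZetaDim139 : FischlerZudilin2010.oddZetaDim139 := by
  have h : 3 ≤ oddZetaSpanRank 69 := kappa3_sweep_three_le_oddZetaSpanRank_le (by norm_num)
  rwa [oddZetaSpanRank_eq_finrank_span_insert] at h

/-- **The rung in words (dimension only)**: some `ζ(k)` with `k` odd, `5 ≤ k ≤ 73`, is NOT of the form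
`u + v ζ(3)` with `u, v ∈ ℚ` — i.e. lies outside `Span_ℚ(1, ζ(3))`. From `kappa3_sweep_three_le_finrank_span`
alone: otherwise every generator of `Span_ℚ(1, ζ(3), …, ζ(73))` lies in `Span_ℚ(1, ζ(3))`, of dimension
`≤ 2` (`finrank_range_le_card`). No `k` is exhibited (the statement is a disjunction over 35 values); weaker,
as an irrationality statement, than Zudilin's one of `ζ(5), ζ(7), ζ(9), ζ(11)`.
[cite: Lai2024BallRivoal, Claim 1.4 (ζ(75)) sharpened to ζ(73); method §4–§5] -/
theorem exists_oddZeta_not_mem_span_one_zetaThree :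
    ∃ k : ℕ, Odd k ∧ 5 ≤ k ∧ k ≤ 73 ∧
      zetaValue k ∉ Submodule.span ℚ (Set.range ![(1 : ℝ), zetaValue 3]) := by
  by_contra hcon
  push Not at hcon
  have h3 := kappa3_sweep_three_le_finrank_span
  have hle : Submodule.span ℚ
      (insert (1 : ℝ) {x | ∃ k : ℕ, Odd k ∧ 3 ≤ k ∧ k ≤ 73 ∧ x = zetaValue k}) ≤
      Submodule.span ℚ (Set.range ![(1 : ℝ), zetaValue 3]) := by
    rw [Submodule.span_le]
    intro x hx
    simp only [Set.mem_insert_iff, Set.mem_setOf_eq] at hx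
    rcases hx with rfl | ⟨k, hk, h3k, hk73, rfl⟩
    · exact Submodule.subset_span ⟨0, by simp⟩
    · by_cases h5 : 5 ≤ k
      · exact hcon k hk h5 hk73
      · obtain ⟨j, rfl⟩ := hk
        have hj : j = 1 := by omega
        subst hj
        exact Submodule.subset_span ⟨1, by simp⟩
  haveI : Module.Finite ℚ (Submodule.span ℚ (Set.range ![(1 : ℝ), zetaValue 3])) :=
    Module.Finite.span_of_finite ℚ (Set.finite_range _)
  have h2 : Module.finrank ℚ (Submodule.span ℚ (Set.range ![(1 : ℝ), zetaValue 3])) ≤ 2 := by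
    have h := finrank_range_le_card (R := ℚ) ![(1 : ℝ), zetaValue 3]
    rwa [Fintype.card_fin] at h
  have := (Submodule.finrank_mono hle).trans h2
  omega

/-- **The rung in words (with Apéry)**: for some odd `k`, `5 ≤ k ≤ 73`, the three numbers `1, ζ(3), ζ(k)`
are linearly independent over `ℚ` — `exists_oddZeta_not_mem_span_one_zetaThree` plus the tree's Apéry
theorem `Apery.irrational_zeta_three` (for the independence of `1, ζ(3)`), via `linearIndependent_finSucc'`.
Compare [FischlerZudilin2010, Thm 3] (`i₁ ≤ 139`, there with a fourth vector `ζ(i₂)`, `i₂ ≤ 1961`, which is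
NOT claimed here). Linear independence only; nothing about `ζ(5)` itself.
[cite: FischlerZudilin2010, Thm 3 (first index 139 ↦ 73, three vectors)] -/
theorem exists_linearIndependent_one_zetaThree_oddZeta :
    ∃ k : ℕ, Odd k ∧ 5 ≤ k ∧ k ≤ 73 ∧ LinearIndependent ℚ ![(1 : ℝ), zetaValue 3, zetaValue k] := by
  obtain ⟨k, hk, h5, h73, hnot⟩ := exists_oddZeta_not_mem_span_one_zetaThree
  refine ⟨k, hk, h5, h73, ?_⟩
  rw [linearIndependent_finSucc']
  have hinit : Fin.init ![(1 : ℝ), zetaValue 3, zetaValue k] = ![(1 : ℝ), zetaValue 3] := by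
    funext i; fin_cases i <;> rfl
  have hlast : ![(1 : ℝ), zetaValue 3, zetaValue k] (Fin.last 2) = zetaValue k := rfl
  rw [hinit, hlast]
  refine ⟨?_, hnot⟩
  rw [linearIndependent_fin2]
  refine ⟨?_, fun a ha => ?_⟩
  · simpa using irrational_zeta_three.ne_zero
  · have ha' : (a : ℝ) * zetaValue 3 = 1 := by simpa [Rat.smul_def] using ha
    have h3 : zetaValue 3 = ((a⁻¹ : ℚ) : ℝ) := by
      rw [Rat.cast_inv]; exact eq_inv_of_mul_eq_one_right ha'
    exact irrational_zeta_three.ne_rat _ h3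

/-! ### The rung over Mathlib's `riemannZeta` (no tree definition under the statement)

The two theorems below restate the certified rung with Mathlib's `riemannZeta` in place of the tree's
`zetaValue` (`PeriodsWave0.zetaValue k = ∑' n, 1/n^k : ℝ`, with `(zetaValue k : ℂ) = riemannZeta k` for
`k ≥ 2`, `ofReal_zetaValue`), so that a reader checks the STATEMENT against Mathlib alone: every symbol
under it — `riemannZeta`, `Complex.re`, `Module.finrank`, `Submodule.span` — is Mathlib's. Added for the
standalone write-up `papers/…/kappa3` (seat kappa3-writer g5, 2026-08-25); no new mathematics. -/

/-- **`κ₃ ≤ 73` over Mathlib's `riemannZeta`, vector form**: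
`3 ≤ dim_ℚ Span_ℚ (range (i ↦ if i = 0 then 1 else Re ζ(2i+1)))` on `Fin 37`, i.e.
`dim_ℚ Span_ℚ(1, ζ(3), ζ(5), …, ζ(73)) ≥ 3` with `ζ = riemannZeta` (real at these points). Hypothesis-free;
`kappa3_sweep_three_le_oddZetaSpanRank` rewritten by `ofReal_zetaValue`.
[cite: Lai2024BallRivoal, Claim 1.4 (ζ(75)) sharpened to ζ(73); method §4–§5] -/
theorem kappa3_three_le_finrank_span_range_riemannZeta :
    3 ≤ Module.finrank ℚ (Submodule.span ℚ (Set.range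
      (fun i : Fin 37 => if (i : ℕ) = 0 then (1 : ℝ) else (riemannZeta (2 * (i : ℕ) + 1)).re))) := by
  have h := kappa3_sweep_three_le_oddZetaSpanRank
  have e : (fun i : Fin 37 => if (i : ℕ) = 0 then (1 : ℝ) else (riemannZeta (2 * (i : ℕ) + 1)).re)
      = oddZetaVec 36 := by
    funext i
    unfold oddZetaVec
    split_ifs with hi
    · rfl
    · have hz := ofReal_zetaValue (k := 2 * (i : ℕ) + 1) (by omega)
      push_cast at hz
      rw [← hz, Complex.ofReal_re]
  rw [e]
  exact h

/-- **`κ₃ ≤ 73` over Mathlib's `riemannZeta`, set form**: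
`3 ≤ dim_ℚ Span_ℚ (insert 1 {Re ζ(k) : k odd, 3 ≤ k ≤ 73})`, `ζ = riemannZeta`. Hypothesis-free;
`kappa3_sweep_three_le_finrank_span` rewritten by `ofReal_zetaValue`. A linear-independence statement;
nothing about any single odd zeta value.
[cite: Lai2024BallRivoal, Claim 1.4 (ζ(75)) sharpened to ζ(73); method §4–§5] -/
theorem kappa3_three_le_finrank_span_insert_riemannZeta :
    3 ≤ Module.finrank ℚ (Submodule.span ℚ
      (insert (1 : ℝ) {x : ℝ | ∃ k : ℕ, Odd k ∧ 3 ≤ k ∧ k ≤ 73 ∧ x = (riemannZeta k).re})) := by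
  have h := kappa3_sweep_three_le_finrank_span
  have hs : {x : ℝ | ∃ k : ℕ, Odd k ∧ 3 ≤ k ∧ k ≤ 73 ∧ x = (riemannZeta k).re}
      = {x : ℝ | ∃ k : ℕ, Odd k ∧ 3 ≤ k ∧ k ≤ 73 ∧ x = zetaValue k} := by
    ext x
    simp only [Set.mem_setOf_eq]
    constructor
    · rintro ⟨k, hk, h3, h73, rfl⟩
      have hz := ofReal_zetaValue (k := k) (by omega)
      exact ⟨k, hk, h3, h73, by rw [← hz, Complex.ofReal_re]⟩
    · rintro ⟨k, hk, h3, h73, rfl⟩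
      have hz := ofReal_zetaValue (k := k) (by omega)
      exact ⟨k, hk, h3, h73, by rw [← hz, Complex.ofReal_re]⟩
  rw [hs]
  exact h

end Summit.KontsevichZagierPeriods.Zeta5Search.Sweep
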